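import Literature.AlgebraicGeometry.Motives.HodgeStructureFourierTransformSL2Action
import Literature.AlgebraicGeometry.Motives.HodgeStructureExteriorAlgebraWeylOperatorDirectSum
import Literature.Algebra.Lie.LefschetzModuleSL2RepresentationFunctoriality
import HarnessLib

/-!
# Beauville's `SL₂(K)`-action on `H•(X × Y) = ⋀(W₁ ⊕ W₂)` is the tensor product of the actions on `⋀W₁` and `⋀W₂`
# (Künneth is an isomorphism of `SL₂`-modules); `ℱ_{X×Y}(x ∧ y) = ℱ_X x ∧ ℱ_Y y`

[topic AlgebraicGeometry/Motives]

Layer `Literature/AlgebraicGeometry/Motives` (namespace `Literature.AlgebraicGeometry.Motives.ExteriorLefschetz`), lane `lit-hodgefound`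
(Track 2 foundations library; prover seat `lit-hodgefound-p34`, generation 38, row g38-#4), the sequel of
`HodgeStructureFourierTransformSL2Action.lean` (row g38-#2: `sl2Action ω g : SL(2, K) →* End(⋀W)`, Beauville's §4 theorem
`(1 a ; 0 1) ↦ e^{aω} ∧ ·`, `(0 −1 ; 1 0) ↦ ℱ`, …), of `HodgeStructureExteriorAlgebraWeylOperatorDirectSum.lean` (row g31-#9: the Künneth
map `Φ = toProd ∘ of : ⋀W₁ ⊗ ⋀W₂ → ⋀(W₁ × W₂)`, `x ⊗ y ↦ ⋀(inl) x ∧ ⋀(inr) y`, is a morphism of Lefschetz modules for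
`ω₁ ⊞ ω₂ = ⋀(inl) ω₁ + ⋀(inr) ω₂`, symplectic of genus `g₁ + g₂`) and of `Literature/Algebra/Lie/LefschetzModuleSL2RepresentationFunctoriality.lean`
(row g38-#3: `map_sl2Rep_of_semiconj`, `sl2Rep_tensor_tmul`).  THEOREMS ONLY (no `def`, no named fact, no instance, no notation; net debt `0`).

## Sources, VERBATIM

* Y. André, *Pour une théorie inconditionnelle des motifs*, Publ. Math. IHÉS 83 (1996) [Andre1996Motifs], §1.3 (p. 12): "L'isomorphisme
  (d'algèbres graduées) de Künneth : `H*(X × Y) ≅ H*(X) ⊗ H*(Y)` devient un isomorphisme de `𝔰𝔩₂`-modules si l'on munit `X × Y` du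
  faisceau inversible ample `pr_X* 𝓛_X ⊗ pr_Y* 𝓛_Y`"; (p. 13, proof of Lemme 1.3.2): "La formule pour l'involution de Hodge découle de
  son interprétation en termes de l'élément `(0 1 ; −1 0)` de `SL₂`."
* A. Beauville, *The action of SL₂ on abelian varieties*, J. Ramanujan Math. Soc. 25 (2010), arXiv:0805.1541 [Beauville2010SL2], §4
  Theorem (held `paper:arxiv-0805.1541` p0005): "`(0 −1 ; 1 0)·z = ℱ(z)`, `(1 a ; 0 1)·z = e^{aθ} z`, …" — the action of `SL₂` on
  `H•` through the Lefschetz `𝔰𝔩₂`-triple of `θ`.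

## What is PROVED (`Ω = ⋀(inl) ω₁ + ⋀(inr) ω₂`, `G = g₁ + g₂ ≥ 1`, `x ∧ y := ⋀(inl) x · ⋀(inr) y`, `Φ = toProd ∘ of`)

* **`IsSymplectic.sl2Action_inl_add_inr_apply`: `ρ_Ω(γ)(x ∧ y) = ρ_{ω₁}(γ) x ∧ ρ_{ω₂}(γ) y`** for every `γ ∈ SL₂(K)` — the abstract
  Künneth statement `ρ_{M ⊗ N}(γ) = ρ_M(γ) ⊗ ρ_N(γ)` (row g38-#3) transported along the morphism of Lefschetz modules `Φ`
  (`Φ ∘ (L_{ω₁} ⊗ 1 + 1 ⊗ L_{ω₂}) = L_Ω ∘ Φ`, `Φ ∘ (h₁ ⊗ 1 + 1 ⊗ h₂) = h ∘ Φ`, row g31-#9; `map_sl2Rep_of_semiconj`, row g38-#3).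
* **`IsSymplectic.sl2Action_comp_kunneth`**: `ρ_Ω(γ) ∘ Φ = Φ ∘ (ρ_{ω₁}(γ) ⊗ ρ_{ω₂}(γ))` — "l'isomorphisme de Künneth devient un isomorphisme
  de `𝔰𝔩₂`-modules", at the level of the group `SL₂(K)`.
* `IsSymplectic.sl2Action_map_inl_apply` (`ρ_Ω(γ)(⋀(inl) x) = ρ_{ω₁}(γ) x ∧ ρ_{ω₂}(γ) 1`), `IsSymplectic.sl2Action_map_inr_apply`.
* **`IsSymplectic.fourierTransform_inl_add_inr_apply`: `ℱ_Ω (x ∧ y) = ℱ_{ω₁} x ∧ ℱ_{ω₂} y`** (`g₁, g₂ ≥ 1`; `ℱ = w = ρ(0 −1 ; 1 0)`,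
  rows g37-#3 / g31-#9), `IsSymplectic.fourierTransform_comp_kunneth`.

## References

* [Andre1996Motifs] Y. André, *Pour une théorie inconditionnelle des motifs*, Publ. Math. IHÉS 83 (1996) 5–49, §1.3 (pp. 12–13).
* [Beauville2010SL2] A. Beauville, *The action of SL₂ on abelian varieties*, J. Ramanujan Math. Soc. 25 (2010) 253–263, arXiv:0805.1541, §4.
* [LooijengaLunts1997] E. Looijenga, V. A. Lunts, *A Lie algebra attached to a projective variety*, Invent. Math. 129 (1997), §1 (1.1) p. 4.
-/

noncomputable section

open scoped TensorProduct MatrixGroups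

namespace Literature.AlgebraicGeometry.Motives

namespace ExteriorLefschetz

open Literature.Algebra.Lie ExteriorAlgebra
open Literature.LinearAlgebra.Alternating (extGrading)

variable {K : Type*} [Field K] [CharZero K] {W₁ W₂ : Type*} [AddCommGroup W₁] [Module K W₁] [AddCommGroup W₂] [Module K W₂]
  {ω₁ : ExteriorAlgebra K W₁} {ω₂ : ExteriorAlgebra K W₂} {g₁ g₂ : ℕ}

/-- **`ρ_{ω₁ ⊞ ω₂}(γ)(x ∧ y) = ρ_{ω₁}(γ) x ∧ ρ_{ω₂}(γ) y`** for every `γ ∈ SL₂(K)` (`g₁ + g₂ ≥ 1`): Beauville's representation of `SL₂(K)`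
on `H•(X × Y) = ⋀(W₁ ⊕ W₂)` is, through the Künneth map, the tensor product of the representations on `H•(X)` and `H•(Y)` — on the
generating unipotents, `e^{a(ω₁ ⊞ ω₂)} ∧ (x ∧ y) = (e^{aω₁} ∧ x) ∧ (e^{aω₂} ∧ y)` and likewise for `exp(a ᶜΛ)`, `ᶜΛ_Ω` being `ᶜΛ₁ ⊗ 1 + 1 ⊗ ᶜΛ₂`.
[cite: Andre1996Motifs, §1.3 (p. 12, "l'isomorphisme de Künneth devient un isomorphisme de 𝔰𝔩₂-modules"; p. 13)] [cite: Beauville2010SL2, §4 Theorem] -/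
theorem IsSymplectic.sl2Action_inl_add_inr_apply (hω₁ : IsSymplectic ω₁ g₁) (hω₂ : IsSymplectic ω₂ g₂) (h12 : 0 < g₁ + g₂)
    (γ : SL(2, K)) (x : ExteriorAlgebra K W₁) (y : ExteriorAlgebra K W₂) :
    sl2Action (ExteriorAlgebra.map (LinearMap.inl K W₁ W₂) ω₁ + ExteriorAlgebra.map (LinearMap.inr K W₁ W₂) ω₂) (g₁ + g₂) γ
        (ExteriorAlgebra.map (LinearMap.inl K W₁ W₂) x * ExteriorAlgebra.map (LinearMap.inr K W₁ W₂) y) =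
      ExteriorAlgebra.map (LinearMap.inl K W₁ W₂) (sl2Action ω₁ g₁ γ x) *
        ExteriorAlgebra.map (LinearMap.inr K W₁ W₂) (sl2Action ω₂ g₂ γ y) := by
  haveI := hω₁.finiteDimensional_exteriorAlgebra
  haveI := hω₂.finiteDimensional_exteriorAlgebra
  have hΩ := hω₁.inl_add_inr hω₂
  haveI := hΩ.finiteDimensional_exteriorAlgebra
  have h0 := rTensor_add_lTensor_shiftedDegree_ne_zero (K := K) (W₁ := W₁) (W₂ := W₂) h12
  have key := (hω₁.hasLefschetzProperty_mul.tensor (isZGrading_shiftedDegree K (fun i : ℕ ↦ ⋀[K]^i W₁) g₁)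
    hω₂.hasLefschetzProperty_mul (isZGrading_shiftedDegree K (fun i : ℕ ↦ ⋀[K]^i W₂) g₂)).map_sl2Rep_of_semiconj
    (isZGrading_rTensor_add_lTensor (isZGrading_shiftedDegree K (fun i : ℕ ↦ ⋀[K]^i W₁) g₁)
      (isZGrading_shiftedDegree K (fun i : ℕ ↦ ⋀[K]^i W₂) g₂))
    hΩ.hasLefschetzProperty_mul (isZGrading_shiftedDegree K (fun i : ℕ ↦ ⋀[K]^i (W₁ × W₂)) (g₁ + g₂))
    (toProd_of_rTensor_add_lTensor_shiftedDegree g₁ g₂) (toProd_of_rTensor_add_lTensor_mul ω₁ hω₂.mem) γ (x ⊗ₜ[K] y)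
  rw [hω₁.hasLefschetzProperty_mul.sl2Rep_tensor_tmul (isZGrading_shiftedDegree K _ g₁) hω₂.hasLefschetzProperty_mul
      (isZGrading_shiftedDegree K _ g₂) h0, toProd_of_tmul, toProd_of_tmul, ← hω₁.sl2Action_eq, ← hω₂.sl2Action_eq,
    ← hΩ.sl2Action_eq] at key
  exact key.symm

/-- **KÜNNETH IS AN ISOMORPHISM OF `SL₂(K)`-MODULES: `ρ_{ω₁ ⊞ ω₂}(γ) ∘ Φ = Φ ∘ (ρ_{ω₁}(γ) ⊗ ρ_{ω₂}(γ))`** for the Künneth algebra map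
`Φ = toProd ∘ of : ⋀W₁ ⊗ ⋀W₂ → ⋀(W₁ × W₂)` (`g₁ + g₂ ≥ 1`). [cite: Andre1996Motifs, §1.3 (p. 12)] [cite: Beauville2010SL2, §4 Theorem] -/
theorem IsSymplectic.sl2Action_comp_kunneth (hω₁ : IsSymplectic ω₁ g₁) (hω₂ : IsSymplectic ω₂ g₂) (h12 : 0 < g₁ + g₂) (γ : SL(2, K)) :
    sl2Action (ExteriorAlgebra.map (LinearMap.inl K W₁ W₂) ω₁ + ExteriorAlgebra.map (LinearMap.inr K W₁ W₂) ω₂) (g₁ + g₂) γ ∘ₗ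
        ((Literature.LinearAlgebra.Alternating.ExteriorDirectSum.toProd K W₁ W₂).toLinearMap ∘ₗ
          (GradedTensorProduct.of K (extGrading K W₁) (extGrading K W₂)).toLinearMap) =
      ((Literature.LinearAlgebra.Alternating.ExteriorDirectSum.toProd K W₁ W₂).toLinearMap ∘ₗ
          (GradedTensorProduct.of K (extGrading K W₁) (extGrading K W₂)).toLinearMap) ∘ₗ
        TensorProduct.map (sl2Action ω₁ g₁ γ) (sl2Action ω₂ g₂ γ) :=
  TensorProduct.ext' fun x y ↦ by
    rw [LinearMap.comp_apply, LinearMap.comp_apply _ (TensorProduct.map _ _), TensorProduct.map_tmul, toProd_of_tmul, toProd_of_tmul]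
    exact hω₁.sl2Action_inl_add_inr_apply hω₂ h12 γ x y

/-- `ρ_{ω₁ ⊞ ω₂}(γ)(⋀(inl) x) = ρ_{ω₁}(γ) x ∧ ρ_{ω₂}(γ) 1` (`y = 1`; note `ρ_{ω₂}(γ) 1 ≠ 1` in general — `1 ∈ H⁰` spans the longest string).
[cite: Andre1996Motifs, §1.3 (p. 12)] [cite: Beauville2010SL2, §4 Theorem] -/
theorem IsSymplectic.sl2Action_map_inl_apply (hω₁ : IsSymplectic ω₁ g₁) (hω₂ : IsSymplectic ω₂ g₂) (h12 : 0 < g₁ + g₂)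
    (γ : SL(2, K)) (x : ExteriorAlgebra K W₁) :
    sl2Action (ExteriorAlgebra.map (LinearMap.inl K W₁ W₂) ω₁ + ExteriorAlgebra.map (LinearMap.inr K W₁ W₂) ω₂) (g₁ + g₂) γ
        (ExteriorAlgebra.map (LinearMap.inl K W₁ W₂) x) =
      ExteriorAlgebra.map (LinearMap.inl K W₁ W₂) (sl2Action ω₁ g₁ γ x) *
        ExteriorAlgebra.map (LinearMap.inr K W₁ W₂) (sl2Action ω₂ g₂ γ 1) := by
  rw [← hω₁.sl2Action_inl_add_inr_apply hω₂ h12 γ x 1, map_one, mul_one]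

/-- `ρ_{ω₁ ⊞ ω₂}(γ)(⋀(inr) y) = ρ_{ω₁}(γ) 1 ∧ ρ_{ω₂}(γ) y`. [cite: Andre1996Motifs, §1.3 (p. 12)] [cite: Beauville2010SL2, §4 Theorem] -/
theorem IsSymplectic.sl2Action_map_inr_apply (hω₁ : IsSymplectic ω₁ g₁) (hω₂ : IsSymplectic ω₂ g₂) (h12 : 0 < g₁ + g₂)
    (γ : SL(2, K)) (y : ExteriorAlgebra K W₂) :
    sl2Action (ExteriorAlgebra.map (LinearMap.inl K W₁ W₂) ω₁ + ExteriorAlgebra.map (LinearMap.inr K W₁ W₂) ω₂) (g₁ + g₂) γ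
        (ExteriorAlgebra.map (LinearMap.inr K W₁ W₂) y) =
      ExteriorAlgebra.map (LinearMap.inl K W₁ W₂) (sl2Action ω₁ g₁ γ 1) *
        ExteriorAlgebra.map (LinearMap.inr K W₁ W₂) (sl2Action ω₂ g₂ γ y) := by
  rw [← hω₁.sl2Action_inl_add_inr_apply hω₂ h12 γ 1 y, map_one, one_mul]

/-- **`ℱ_{ω₁ ⊞ ω₂}(x ∧ y) = ℱ_{ω₁} x ∧ ℱ_{ω₂} y`** (`g₁, g₂ ≥ 1`): the cohomological Fourier transform of a product is the product of the
Fourier transforms — `ℱ = w = ρ(0 −1 ; 1 0)` (rows g37-#3, g38-#2) and the Weyl element acts diagonally on a tensor product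
("interprétation en termes de l'élément `(0 1 ; −1 0)` de `SL₂`", row g31-#9 `weylStar_inl_add_inr_apply`).
[cite: Beauville2010SL2, §4 Theorem ("(0 −1 ; 1 0)·z = ℱ(z)")] [cite: Andre1996Motifs, §1.3 Lemme 1.3.2 (p. 13, proof)] -/
theorem IsSymplectic.fourierTransform_inl_add_inr_apply (hω₁ : IsSymplectic ω₁ g₁) (hω₂ : IsSymplectic ω₂ g₂) (hg₁ : 0 < g₁)
    (hg₂ : 0 < g₂) (x : ExteriorAlgebra K W₁) (y : ExteriorAlgebra K W₂) :
    fourierTransform (ExteriorAlgebra.map (LinearMap.inl K W₁ W₂) ω₁ + ExteriorAlgebra.map (LinearMap.inr K W₁ W₂) ω₂) (g₁ + g₂)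
        (ExteriorAlgebra.map (LinearMap.inl K W₁ W₂) x * ExteriorAlgebra.map (LinearMap.inr K W₁ W₂) y) =
      ExteriorAlgebra.map (LinearMap.inl K W₁ W₂) (fourierTransform ω₁ g₁ x) *
        ExteriorAlgebra.map (LinearMap.inr K W₁ W₂) (fourierTransform ω₂ g₂ y) := by
  rw [(hω₁.inl_add_inr hω₂).fourierTransform_eq_weylStar (add_pos hg₁ hg₂), hω₁.fourierTransform_eq_weylStar hg₁,
    hω₂.fourierTransform_eq_weylStar hg₂]
  exact hω₁.weylStar_inl_add_inr_apply hω₂ (add_pos hg₁ hg₂) x y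

/-- **`ℱ_{ω₁ ⊞ ω₂} ∘ Φ = Φ ∘ (ℱ_{ω₁} ⊗ ℱ_{ω₂})`** for the Künneth algebra map `Φ` (`g₁, g₂ ≥ 1`). [cite: Beauville2010SL2, §4 Theorem]
[cite: Andre1996Motifs, §1.3 Lemme 1.3.2 (p. 13, proof)] -/
theorem IsSymplectic.fourierTransform_comp_kunneth (hω₁ : IsSymplectic ω₁ g₁) (hω₂ : IsSymplectic ω₂ g₂) (hg₁ : 0 < g₁) (hg₂ : 0 < g₂) :
    fourierTransform (ExteriorAlgebra.map (LinearMap.inl K W₁ W₂) ω₁ + ExteriorAlgebra.map (LinearMap.inr K W₁ W₂) ω₂) (g₁ + g₂) ∘ₗ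
        ((Literature.LinearAlgebra.Alternating.ExteriorDirectSum.toProd K W₁ W₂).toLinearMap ∘ₗ
          (GradedTensorProduct.of K (extGrading K W₁) (extGrading K W₂)).toLinearMap) =
      ((Literature.LinearAlgebra.Alternating.ExteriorDirectSum.toProd K W₁ W₂).toLinearMap ∘ₗ
          (GradedTensorProduct.of K (extGrading K W₁) (extGrading K W₂)).toLinearMap) ∘ₗ
        TensorProduct.map (fourierTransform ω₁ g₁) (fourierTransform ω₂ g₂) :=
  TensorProduct.ext' fun x y ↦ by
    rw [LinearMap.comp_apply, LinearMap.comp_apply _ (TensorProduct.map _ _), TensorProduct.map_tmul, toProd_of_tmul, toProd_of_tmul]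
    exact hω₁.fourierTransform_inl_add_inr_apply hω₂ hg₁ hg₂ x y

end ExteriorLefschetz

end Literature.AlgebraicGeometry.Motives
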